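import Literature.Barriers.RiemannHypothesis.FeketePolyaPositivityChowla163
import HarnessLib

/-!
# Order one of Chowla's induced-character evasion: split primes are fatal, inert primes are free — the primorial chain (barrier audit of `FeketePolyaPositivity`, gen 3)

Sibling of `Literature/Barriers/RiemannHypothesis/FeketePolyaPositivity.lean` (catalogue entry
`FeketePolyaPositivity`), of `FeketePolyaPositivityProofs.lean` (the order-one Fekete–Pólya
criterion `LFunction_re_pos_of_summatory_nonneg` and MV Exercise 11.2.1.8) and of
`FeketePolyaPositivityChowla.lean` (the parity-corrected conjecture
`ChowlaInducedCharacterConjectureOdd`: every odd primitive quadratic `χ` mod `q` has an induced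
character `χ↑m = changeLevel (q ∣ m) χ` with `S_1(N, χ↑m) ≥ 0` for all `N ≥ 1`). Written for the
third barrier audit (2026-08-16). Everything here is PROVED; the file declares no definitions.

## What is proved

For a character `χ` mod `q`, a multiple `m` of `q` and a prime `p ∣ m`, the partial sums of the
induced character `χ↑m` satisfy the one-prime inclusion–exclusion
`S_1(N, χ↑m) = S_1(N, χ↑m') − Re χ(p) · S_1(⌊N/p⌋, χ↑m')`, where `m'` is `m` with the `p`-part
removed (`summatory_sift_eq`, in the abstract form below). Consequences:

* `exists_summatory_changeLevel_neg_of_apply_eq_one` — **split primes are fatal at order one**: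
  if `χ ≠ χ₀`, `q ∣ m`, `p ∣ m` is prime and `χ(p) = 1`, then `S_1(N, χ↑m) < 0` for some `N ≥ 1`.
  Mechanism (`sum_summatory_sift_eq_zero`): with `χ(p) = 1` the mean of `S_1(·, χ↑m)` over the
  period `p · m'` is `0` (it is `L(0, χ↑m) = L(0, χ↑m')(1 − χ(p)) = 0`; here by a direct count),
  while `S_1(1, χ↑m) = 1 > 0`. This is the order-one analogue of Louboutin's all-orders
  Lemma 6.1 (2) ("If `m(φ) = ∞` and `φ(p) ≠ −1`, then `m(φ^{(p)}) = ∞`") and Proposition 6.2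
  ("If `d_χ > 1`, then `d_χ` is squarefree and such that `p ∣ d_χ` implies `χ(p) = −1`"), but
  unconditional: at order one a split prime in the modulus is not merely useless, it destroys the
  hypothesis whatever the other prime factors are. [cite: Louboutin2013Chowla, Lemma 6.1 and Proposition 6.2]
* `summatory_changeLevel_mul_nonneg_of_apply_eq_neg_one` — **inert primes are free**: if
  `S_1(·, χ↑m) ≥ 0` and `χ(p) = −1` (`p` prime), then `S_1(·, χ↑(m p)) ≥ 0`
  (`S_1(N, χ↑(mp)) = S_1(N, χ↑m) + S_1(⌊N/p⌋, χ↑m)`; Louboutin's Lemma 6.1 (3) at order one).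
* `apply_ne_one_of_summatory_changeLevel_nonneg` — hence an order-one witness modulus `m` for
  `ChowlaInducedCharacterConjectureOdd` has `χ(p) ≠ 1` for every prime `p ∣ m`: up to primes
  dividing `q` (which change nothing) it is a product of inert primes, and by the previous item one
  may take ALL inert primes up to the largest one — the conjecture at `χ` is the one-parameter
  question whether some `D_t = p_1 ⋯ p_t` (the first `t` primes with `χ(p) = −1`) works, exactly
  Louboutin's chain `D_t(χ)` for the all-orders invariant. [cite: Louboutin2013Chowla, §6]

For `χ_{−163}` the sibling `FeketePolyaPositivityChowla163.lean` shows that such a modulus needs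
at least ten of the twelve primes `≤ 37`; the audit's numerics (not formalised; folder `num/` of
the audit) find along the chain: `S_1(N, χ_{−163}↑(163 D_t)) < 0` first at
`N = 37, 109, 139, 149, 241, 271, 277, 293, 331, 337, 353, 619, 631, 997, 1009` for `t = 10, …, 24`,
and NO negative value for `N ≤ 10^8` when `t ≥ 25` (`p_25 = 149`); and for the all-orders
criterion `F(x, χ↑(163 D_t)) = ∑_{d ∣ D_t} F(x^d, χ) > 0` on `(0, 1)`: false for `t ≤ 17`, true
numerically for `t ≥ 18` (minimum `2.4156` at `x = 0.99824` for `t = 18`), i.e. `t_χ = 18` in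
Louboutin's notation ("We have not found any of these two invariants" [cite: Louboutin2013Chowla, §7]).

## References

* [Louboutin2013Chowla] S. Louboutin, *On the size of `L(1,χ)` and S. Chowla's hypothesis
  implying that `L(1,χ) > 0` for `s > 0` and for real characters `χ`*, Colloq. Math. 130 (2013),
  79–90 (read: Lemma 6.1, Proposition 6.2 p. 87–88, §7 pp. 88–89).
* [Louboutin2003] S. R. Louboutin, Colloq. Math. 96 (2003), 207–212, p. 207 (the parity-corrected
  conjecture).
* [MontgomeryVaughan2007] H. L. Montgomery, R. C. Vaughan, *Multiplicative Number Theory I*, CUP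
  2007, §11.2.1 Exercise 8.

## Design notes

* The combinatorial core is stated for a real sequence `f` (period `M`, zero period sum,
  `f (p k) = c · f k`) and its sifted version `fun n ↦ if p ∣ n then 0 else f n`; the character
  statements instantiate `f n = Re χ↑m'(n)` with `m'` the prime-to-`p` part of `m`
  (`Nat.factorization`, `ordCompl[p] m`), `c = Re χ(p)`.
* `S_1` is the sibling files' `summatory`; `⌊N/p⌋` is `ℕ`-division; "`p ∣ m` prime with
  `χ(p) = 1`" forces `p ∤ q`, which is derived, not assumed.
-/

noncomputable section

open Finset

namespace Literature.Barriers.RiemannHypothesis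

/-! ## The combinatorial core: sifting one prime out of a periodic sequence -/

section Sift

variable (f : ℕ → ℝ) (p : ℕ)

/-- **One-prime inclusion–exclusion.** If `f (p k) = c · f k` for all `k` (and `0 < p`), then
`∑_{n ≤ N, p ∤ n} f(n) = S(N) − c · S(⌊N/p⌋)` with `S = summatory f`. [folklore] -/
theorem summatory_sift_eq (hp : 0 < p) (c : ℝ) (hmul : ∀ k, f (p * k) = c * f k) (N : ℕ) :
    summatory (fun n ↦ if p ∣ n then 0 else f n) N = summatory f N - c * summatory f (N / p) := by
  induction N with
  | zero => simp [Nat.zero_div]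
  | succ N ih =>
    rw [summatory_succ, summatory_succ, ih]
    by_cases h : p ∣ N + 1
    · rw [if_pos h, Nat.succ_div_of_dvd h, summatory_succ]
      obtain ⟨k, hk⟩ := h
      have e1 : N / p + 1 = k := by
        rw [← Nat.succ_div_of_dvd ⟨k, hk⟩, hk, Nat.mul_div_cancel_left k hp]
      rw [e1, hk, hmul]
      ring
    · rw [if_neg h, Nat.succ_div_of_not_dvd h]
      ring

/-- Zero period sum and periodicity make the summatory function periodic:
`S(N + M) = S(N)`. [folklore] -/
theorem summatory_add_period {M : ℕ} (hper : ∀ n, f (n + M) = f n)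
    (hsum : summatory f M = 0) (N : ℕ) : summatory f (N + M) = summatory f N := by
  induction N with
  | zero => simpa using hsum
  | succ N ih =>
    rw [show N + 1 + M = (N + M) + 1 by omega, summatory_succ, summatory_succ, ih,
      show N + M + 1 = (N + 1) + M by omega, hper]

/-- Iterated periodicity: `S(N + k M) = S(N)`. [folklore] -/
theorem summatory_add_mul_period {M : ℕ} (hper : ∀ n, f (n + M) = f n)
    (hsum : summatory f M = 0) (k N : ℕ) : summatory f (N + k * M) = summatory f N := by
  induction k with
  | zero => simp
  | succ k ih =>
    rw [show N + (k + 1) * M = (N + k * M) + M by ring, summatory_add_period f hper hsum, ih]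

/-- Sum of `S` over `k` periods: `∑_{N=1}^{kM} S(N) = k ∑_{N=1}^{M} S(N)` (written with `range` and
the shift `N = i + 1`). [folklore] -/
theorem sum_range_mul_summatory {M : ℕ} (hper : ∀ n, f (n + M) = f n)
    (hsum : summatory f M = 0) (k : ℕ) :
    ∑ i ∈ range (k * M), summatory f (i + 1) = k * ∑ i ∈ range M, summatory f (i + 1) := by
  induction k with
  | zero => simp
  | succ k ih =>
    rw [show (k + 1) * M = k * M + M by ring, Finset.sum_range_add, ih, Nat.cast_add,
      Nat.cast_one, add_mul, one_mul]
    congr 1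
    refine Finset.sum_congr rfl fun i _ ↦ ?_
    rw [show k * M + i + 1 = (i + 1) + k * M by ring, summatory_add_mul_period f hper hsum]

/-- One block of the floor-division sum: for `0 < p`,
`∑_{r < p} S(⌊(V p + r + 1)/p⌋) = (p − 1) S(V) + S(V + 1)` (written with `p = p' + 1`). [folklore] -/
theorem sum_range_summatory_div_block (p' V : ℕ) :
    ∑ r ∈ range (p' + 1), summatory f ((V * (p' + 1) + r + 1) / (p' + 1)) =
      p' * summatory f V + summatory f (V + 1) := by
  rw [Finset.sum_range_succ]
  have hlast : (V * (p' + 1) + p' + 1) / (p' + 1) = V + 1 := by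
    rw [show V * (p' + 1) + p' + 1 = (V + 1) * (p' + 1) by ring, Nat.mul_div_cancel _ (by omega)]
  have hrest : ∀ r ∈ range p', summatory f ((V * (p' + 1) + r + 1) / (p' + 1)) = summatory f V := by
    intro r hr
    have hr' : r + 1 < p' + 1 := by have := mem_range.1 hr; omega
    congr 1
    rw [show V * (p' + 1) + r + 1 = (r + 1) + (p' + 1) * V by ring, Nat.add_mul_div_left _ _ (by omega),
      Nat.div_eq_of_lt hr', zero_add]
  rw [hlast, Finset.sum_congr rfl hrest, Finset.sum_const, card_range, nsmul_eq_mul]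

/-- The floor-division sum over `V` blocks:
`∑_{i < V p} S(⌊(i+1)/p⌋) = p ∑_{v < V} S(v + 1) − (p − 1) S(V)` (uses `S(0) = 0`). [folklore] -/
theorem sum_range_summatory_div (p' V : ℕ) :
    ∑ i ∈ range (V * (p' + 1)), summatory f ((i + 1) / (p' + 1)) =
      (p' + 1) * ∑ v ∈ range V, summatory f (v + 1) - p' * summatory f V := by
  induction V with
  | zero => simp
  | succ V ih =>
    rw [show (V + 1) * (p' + 1) = V * (p' + 1) + (p' + 1) by ring, Finset.sum_range_add, ih,
      sum_range_summatory_div_block f p' V, Finset.sum_range_succ]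
    ring

/-- **Mean zero.** If `f` has period `M` with zero period sum and `f (p k) = f k` for all `k`
(`p ≥ 1`), then the sifted summatory function has zero sum over the period `M p`:
`∑_{N=1}^{Mp} ∑_{n ≤ N, p ∤ n} f(n) = 0`. (For `f = Re χ↑m'` and a split prime `p` this is
`L(0, χ↑(m' p)) = 0`.) [folklore] -/
theorem sum_summatory_sift_eq_zero {M : ℕ} (hper : ∀ n, f (n + M) = f n)
    (hsum : summatory f M = 0) (p' : ℕ) (hmul : ∀ k, f ((p' + 1) * k) = f k) :
    ∑ i ∈ range (M * (p' + 1)), summatory (fun n ↦ if (p' + 1) ∣ n then 0 else f n) (i + 1) = 0 := by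
  have hie : ∀ i, summatory (fun n ↦ if (p' + 1) ∣ n then 0 else f n) (i + 1) =
      summatory f (i + 1) - summatory f ((i + 1) / (p' + 1)) := by
    intro i
    have := summatory_sift_eq f (p' + 1) (by omega) 1 (by simpa using hmul) (i + 1)
    simpa using this
  simp_rw [hie]
  rw [Finset.sum_sub_distrib, sum_range_summatory_div f p' M, hsum, mul_zero, sub_zero,
    show M * (p' + 1) = (p' + 1) * M by ring, sum_range_mul_summatory f hper hsum (p' + 1)]
  push_cast
  ring

/-- **A negative value.** Under the hypotheses of `sum_summatory_sift_eq_zero`, if moreover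
`f 1 > 0`, `p ≥ 2` and `M ≥ 1`, some sifted partial sum `∑_{n ≤ N, p ∤ n} f(n)`, `1 ≤ N ≤ M p`, is
negative (a zero sum of reals with a positive term has a negative term). [folklore] -/
theorem exists_summatory_sift_neg {M : ℕ} (hM : 0 < M) (hper : ∀ n, f (n + M) = f n)
    (hsum : summatory f M = 0) (p' : ℕ) (hp' : 0 < p') (hmul : ∀ k, f ((p' + 1) * k) = f k)
    (h1 : 0 < f 1) :
    ∃ N : ℕ, 1 ≤ N ∧ summatory (fun n ↦ if (p' + 1) ∣ n then 0 else f n) N < 0 := by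
  by_contra! hnn
  have hz := sum_summatory_sift_eq_zero f hper hsum p' hmul
  have hpos : 0 < ∑ i ∈ range (M * (p' + 1)),
      summatory (fun n ↦ if (p' + 1) ∣ n then 0 else f n) (i + 1) := by
    refine Finset.sum_pos' (fun i _ ↦ hnn (i + 1) (by omega)) ⟨0, ?_, ?_⟩
    · exact mem_range.2 (Nat.mul_pos hM (by omega))
    · rw [zero_add, summatory_succ, summatory_zero, zero_add]
      have hnd : ¬ (p' + 1 ∣ 1) := by
        intro h; have := Nat.le_of_dvd one_pos h; omega
      simpa [hnd] using h1
  exact absurd hz hpos.ne'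

end Sift

/-! ## Characters: one prime in or out of the modulus -/

section Character

open DirichletCharacter

variable {q : ℕ} [NeZero q] (χ : DirichletCharacter ℂ q)

omit [NeZero q] in
/-- Values of an induced character on naturals: `Re χ↑m (n) = Re χ(n)` if `gcd(n, m) = 1`, else
`0`. [folklore] -/
theorem re_changeLevel_apply_natCast {m : ℕ} [NeZero m] (hm : q ∣ m) (n : ℕ) :
    (changeLevel hm χ (n : ZMod m)).re = if n.Coprime m then (χ (n : ZMod q)).re else 0 := by
  split_ifs with h
  · have hc : IsCoprime (n : ℤ) (m : ℤ) := Nat.isCoprime_iff_coprime.2 h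
    have key := changeLevel_eq_cast_of_dvd' χ hm hc
    rw [Int.cast_natCast, Int.cast_natCast] at key
    rw [key]
  · have hu : ¬ IsUnit ((n : ℕ) : ZMod m) := by rwa [ZMod.isUnit_iff_coprime]
    rw [MulChar.map_nonunit _ hu, Complex.zero_re]

omit [NeZero q] in
/-- Sifting one more prime: `Re χ↑(m p) (n) = 0` if `p ∣ n` and `= Re χ↑m (n)` otherwise
(`p` prime; whether or not `p ∣ m`). [folklore] -/
theorem re_changeLevel_mul_apply_natCast {m : ℕ} [NeZero m] (hm : q ∣ m) {p : ℕ} (hp : p.Prime)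
    [NeZero (m * p)] (hmp : q ∣ m * p) (n : ℕ) :
    (changeLevel hmp χ (n : ZMod (m * p))).re =
      if p ∣ n then 0 else (changeLevel hm χ (n : ZMod m)).re := by
  rw [re_changeLevel_apply_natCast χ hmp, re_changeLevel_apply_natCast χ hm]
  by_cases hpn : p ∣ n
  · rw [if_pos hpn, if_neg]
    exact Nat.not_coprime_of_dvd_of_dvd hp.one_lt hpn (dvd_mul_left p m) ∘ id
  · rw [if_neg hpn]
    have hnp : n.Coprime p := ((Nat.Prime.coprime_iff_not_dvd hp).2 hpn).symm
    by_cases hc : n.Coprime m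
    · rw [if_pos (Nat.Coprime.mul_right hc hnp), if_pos hc]
    · rw [if_neg hc, if_neg]
      exact fun h' ↦ hc (h'.coprime_dvd_right (dvd_mul_right m p))

omit [NeZero q] in
/-- The real sequence `n ↦ Re χ↑m (n)` has period `m`. [folklore] -/
theorem re_changeLevel_periodic {m : ℕ} [NeZero m] (hm : q ∣ m) (n : ℕ) :
    (changeLevel hm χ ((n + m : ℕ) : ZMod m)).re = (changeLevel hm χ (n : ZMod m)).re := by
  push_cast
  rw [ZMod.natCast_self, add_zero]

omit [NeZero q] in
/-- A full period of a non-principal induced character sums to zero: `S_1(m, χ↑m) = 0`. [folklore] -/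
theorem summatory_re_changeLevel_level (hχ : χ ≠ 1) {m : ℕ} [NeZero m] (hm : q ∣ m) :
    summatory (fun n ↦ (changeLevel hm χ (n : ZMod m)).re) m = 0 := by
  have h1 : changeLevel hm χ ≠ 1 := fun h ↦ hχ ((changeLevel_eq_one_iff hm).mp h)
  have hper := Literature.NumberTheory.LFunctions.DirichletAbel.partialSum_add_level _ h1 0
  rw [zero_add, Literature.NumberTheory.LFunctions.DirichletAbel.partialSum_zero] at hper
  rw [← re_partialSum_eq_summatory, hper, Complex.zero_re]

/-- **Split primes are fatal at order one.** If `χ ≠ χ₀` is a character mod `q`, `q ∣ m`, and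
`m` has a prime factor `p` with `χ(p) = 1`, then the induced character `χ↑m` has a negative
partial sum: `S_1(N, χ↑m) < 0` for some `N ≥ 1`. (With `m = p^a M`, `p ∤ M`:
`S_1(N, χ↑m) = S_1(N, χ↑M) − S_1(⌊N/p⌋, χ↑M)` has mean `0` over the period `p M` — this is
`L(0, χ↑m) = 0` — and the value `1` at `N = 1`.) Order-one, unconditional form of "if `m(φ) = ∞`
and `φ(p) ≠ −1`, then `m(φ^{(p)}) = ∞`" and of "`p ∣ d_χ` implies `χ(p) = −1`".
[cite: Louboutin2013Chowla, Lemma 6.1 (2) and Proposition 6.2] -/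
theorem exists_summatory_changeLevel_neg_of_apply_eq_one (hχ : χ ≠ 1) {m : ℕ} [NeZero m]
    (hm : q ∣ m) {p : ℕ} (hp : p.Prime) (hpm : p ∣ m) (hχp : χ (p : ZMod q) = 1) :
    ∃ N : ℕ, 1 ≤ N ∧ summatory (fun n ↦ (changeLevel hm χ (n : ZMod m)).re) N < 0 := by
  -- the prime-to-`p` part `M` of `m`
  have hm0 : m ≠ 0 := NeZero.ne m
  set a := m.factorization p with ha
  set M := m / p ^ a with hM
  have hmeq : p ^ a * M = m := Nat.ordProj_mul_ordCompl_eq_self m p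
  have ha1 : 0 < a := hp.factorization_pos_of_dvd hm0 hpm
  have hpM : Nat.Coprime p M := Nat.coprime_ordCompl hp hm0
  have hM0 : 0 < M := Nat.ordCompl_pos p hm0
  haveI : NeZero M := ⟨hM0.ne'⟩
  -- `p` is prime to `q` since `χ(p) ≠ 0`, so `q ∣ M`
  have hpq : Nat.Coprime p q := by
    have hu : IsUnit ((p : ℕ) : ZMod q) := by
      by_contra hu
      rw [MulChar.map_nonunit _ hu] at hχp
      exact zero_ne_one hχp
    exact (ZMod.isUnit_iff_coprime p q).1 hu
  have hqM : q ∣ M :=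
    (Nat.Coprime.pow_left a hpq).symm.dvd_of_dvd_mul_left (hmeq ▸ hm)
  -- `f = Re χ↑M`
  have hM1 : changeLevel hqM χ ≠ 1 := fun h ↦ hχ ((changeLevel_eq_one_iff hqM).mp h)
  set f : ℕ → ℝ := fun n ↦ (changeLevel hqM χ (n : ZMod M)).re with hf
  have hper : ∀ n, f (n + M) = f n := fun n ↦ re_changeLevel_periodic χ hqM n
  have hsum : summatory f M = 0 := summatory_re_changeLevel_level χ hχ hqM
  have h1 : 0 < f 1 := by simp [hf]
  have hmul : ∀ k, f (p * k) = f k := by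
    intro k
    have hc : IsCoprime (p : ℤ) (M : ℤ) := Nat.isCoprime_iff_coprime.2 hpM
    have key := changeLevel_eq_cast_of_dvd' χ hqM hc
    rw [Int.cast_natCast, Int.cast_natCast] at key
    simp only [hf]
    rw [Nat.cast_mul, map_mul, key, hχp, one_mul]
  -- values of `χ↑m`: `m = M · p^a`, and coprimality to `p^a` is non-divisibility by `p`
  haveI : NeZero (M * p) := ⟨Nat.mul_ne_zero hM0.ne' hp.ne_zero⟩
  have hqMp : q ∣ M * p := hqM.mul_right p
  have hval : ∀ n : ℕ, (changeLevel hm χ (n : ZMod m)).re = if p ∣ n then 0 else f n := by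
    intro n
    rw [← re_changeLevel_mul_apply_natCast χ hqM hp hqMp n, re_changeLevel_apply_natCast χ hm,
      re_changeLevel_apply_natCast χ hqMp]
    have hiff : n.Coprime m ↔ n.Coprime (M * p) := by
      rw [← hmeq, Nat.coprime_mul_iff_right, Nat.coprime_mul_iff_right,
        Nat.coprime_pow_right_iff ha1, and_comm]
    simp only [hiff]
  -- the combinatorial core with `p = p' + 1`
  obtain ⟨p', rfl⟩ : ∃ p', p = p' + 1 := ⟨p - 1, by have := hp.one_lt; omega⟩
  have hp' : 0 < p' := by have := hp.two_le; omega
  obtain ⟨N, hN, hlt⟩ := exists_summatory_sift_neg f hM0 hper hsum p' hp' hmul h1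
  refine ⟨N, hN, ?_⟩
  have hfun : (fun n : ℕ ↦ (changeLevel hm χ (n : ZMod m)).re) =
      fun n ↦ if p' + 1 ∣ n then 0 else f n := funext hval
  rwa [hfun]

/-- Hence **an order-one Chowla modulus has no split prime factor**: if `S_1(N, χ↑m) ≥ 0` for all
`N ≥ 1` (`χ ≠ χ₀`), then `χ(p) ≠ 1` for every prime `p ∣ m`.
[cite: Louboutin2013Chowla, Proposition 6.2] -/
theorem apply_ne_one_of_summatory_changeLevel_nonneg (hχ : χ ≠ 1) {m : ℕ} [NeZero m]
    (hm : q ∣ m)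
    (hS : ∀ N : ℕ, 1 ≤ N → 0 ≤ summatory (fun n ↦ (changeLevel hm χ (n : ZMod m)).re) N)
    {p : ℕ} (hp : p.Prime) (hpm : p ∣ m) : χ (p : ZMod q) ≠ 1 := fun h ↦ by
  obtain ⟨N, hN, hlt⟩ := exists_summatory_changeLevel_neg_of_apply_eq_one χ hχ hm hp hpm h
  exact absurd (hS N hN) (not_le.2 hlt)

omit [NeZero q] in
/-- **Inert primes are free at order one** (Louboutin's Lemma 6.1 (3) at order one): for a prime
`p` with `χ(p) = −1`, `S_1(N, χ↑(m p)) = S_1(N, χ↑m) + S_1(⌊N/p⌋, χ↑m)` when `p ∤ m` (and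
`= S_1(N, χ↑m)` when `p ∣ m`), so `S_1(·, χ↑m) ≥ 0` implies `S_1(·, χ↑(m p)) ≥ 0`.
[cite: Louboutin2013Chowla, Lemma 6.1 (3)] -/
theorem summatory_changeLevel_mul_nonneg_of_apply_eq_neg_one {m : ℕ} [NeZero m] (hm : q ∣ m)
    {p : ℕ} (hp : p.Prime) (hχp : χ (p : ZMod q) = -1) [NeZero (m * p)] (hmp : q ∣ m * p)
    (hS : ∀ N : ℕ, 1 ≤ N → 0 ≤ summatory (fun n ↦ (changeLevel hm χ (n : ZMod m)).re) N)
    (N : ℕ) : 0 ≤ summatory (fun n ↦ (changeLevel hmp χ (n : ZMod (m * p))).re) N := by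
  set f : ℕ → ℝ := fun n ↦ (changeLevel hm χ (n : ZMod m)).re with hf
  have hS' : ∀ N : ℕ, 0 ≤ summatory f N := fun N ↦ by
    rcases Nat.eq_zero_or_pos N with rfl | hN
    · simp
    · exact hS N hN
  have hfun : (fun n : ℕ ↦ (changeLevel hmp χ (n : ZMod (m * p))).re) =
      fun n ↦ if p ∣ n then 0 else f n := funext (re_changeLevel_mul_apply_natCast χ hm hp hmp)
  rw [hfun]
  by_cases hpm : p ∣ m
  · -- `p ∣ m`: the sifted sequence is `f` itself
    have hf0 : ∀ n, (if p ∣ n then 0 else f n) = f n := by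
      intro n
      split_ifs with h
      · simp only [hf]
        rw [re_changeLevel_apply_natCast χ hm, if_neg]
        exact Nat.not_coprime_of_dvd_of_dvd hp.one_lt h hpm
      · rfl
    simp only [hf0]
    exact hS' N
  · have hpM : IsCoprime (p : ℤ) (m : ℤ) :=
      Nat.isCoprime_iff_coprime.2 ((Nat.Prime.coprime_iff_not_dvd hp).2 hpm)
    have key := changeLevel_eq_cast_of_dvd' χ hm hpM
    rw [Int.cast_natCast, Int.cast_natCast] at key
    have hmul : ∀ k, f (p * k) = (-1) * f k := by
      intro k
      simp only [hf]
      rw [Nat.cast_mul, map_mul, key, hχp]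
      simp
    rw [summatory_sift_eq f p hp.pos (-1) hmul N]
    have := hS' N
    have := hS' (N / p)
    linarith

/-- What this means for `ChowlaInducedCharacterConjectureOdd`: the modulus `m` it provides for
an odd primitive quadratic `ψ` mod `q` is automatically free of split primes — every prime
`p ∣ m` has `ψ(p) ∈ {0, −1}`; by `summatory_changeLevel_mul_nonneg_of_apply_eq_neg_one` one may
moreover throw in any further inert primes, so the conjecture at `ψ` asks whether some product
`D_t` of the first `t` inert primes works (Louboutin's chain). [cite: Louboutin2013Chowla, Proposition 6.2] -/
theorem ChowlaInducedCharacterConjectureOdd.witness_no_split_prime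
    (h : ChowlaInducedCharacterConjectureOdd) {q : ℕ} [NeZero q] (ψ : DirichletCharacter ℂ q)
    (hprim : ψ.IsPrimitive) (h1 : ψ ≠ 1) (hquad : ψ.IsQuadratic) (hodd : ψ.Odd) :
    ∃ (m : ℕ) (hm : q ∣ m), m ≠ 0 ∧ (∀ p : ℕ, p.Prime → p ∣ m → ψ (p : ZMod q) ≠ 1) ∧
      ∀ N : ℕ, 1 ≤ N →
        0 ≤ iterSummatory (fun n ↦ (changeLevel hm ψ (n : ZMod m)).re) 1 N := by
  obtain ⟨m, hm, hm0, hS⟩ := h q ψ hprim h1 hquad hodd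
  haveI : NeZero m := ⟨hm0⟩
  refine ⟨m, hm, hm0, fun p hp hpm ↦ ?_, hS⟩
  exact apply_ne_one_of_summatory_changeLevel_nonneg ψ h1 hm
    (by simpa [iterSummatory_succ] using hS) hp hpm

/-- At the barrier's own character: an order-one Chowla modulus for `χ_{−163}` is divisible by
none of the split primes `41, 43, 47, 53, 61, 71` (the first values of Euler's `n² + n + 41`),
while (`chowla_inducing_modulus_chi163`) it is divisible by at least ten of the twelve inert
primes `≤ 37`. [cite: Louboutin2013Chowla, §7] -/
theorem chowla_modulus_chi163_not_dvd {m : ℕ} [NeZero m] (hm : 163 ∣ m)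
    (hS : ∀ N : ℕ, 1 ≤ N →
      0 ≤ summatory (fun n ↦ (changeLevel hm chi163Char (n : ZMod m)).re) N) :
    ¬ 41 ∣ m ∧ ¬ 43 ∣ m ∧ ¬ 47 ∣ m ∧ ¬ 53 ∣ m ∧ ¬ 61 ∣ m ∧ ¬ 71 ∣ m := by
  have key : ∀ p : ℕ, p.Prime → chi163 p = 1 → ¬ p ∣ m := by
    intro p hp hv hpm
    refine apply_ne_one_of_summatory_changeLevel_nonneg chi163Char chi163Char_ne_one hm hS hp hpm ?_
    rw [chi163Char_apply_natCast, hv, Complex.ofReal_one]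
  refine ⟨key 41 (by norm_num) ?_, key 43 (by norm_num) ?_, key 47 (by norm_num) ?_,
    key 53 (by norm_num) ?_, key 61 (by norm_num) ?_, key 71 (by norm_num) ?_⟩ <;>
    (simp only [chi163]; norm_num)

end Character

end Literature.Barriers.RiemannHypothesis

end
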